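import Summits.ResolutionOfSingularities.ResolutionOfSingularities.Theorems.EquisingularLiftEquisingularLiftNatNDRoundModelSplit
import Summits.ResolutionOfSingularities.ResolutionOfSingularities.Theorems.EquisingularLiftEquisingularLiftNatNDRoundPropsP
import Summits.ResolutionOfSingularities.ResolutionOfSingularities.Theorems.EquisingularLiftEquisingularLiftNatNDFrameRegular
import HarnessLib

/-!
# [OURS · L1 W4.5(b) · EL♮(3)] K-LOC compositions over the `₀` round layer — `ND.roundAtNDFrameLN₀_of_model`, `ND.ndInvLNP_round_of`,
# `ND.linkedTower_of_goodPlay₀`, `ND.transportRoundLN₀_of_toricStage` (SPEC K6-loc v5 27cc057a65e2cfb4 §L0 l.143–224 VERBATIM, idea-1 ★18 «these four are (L-δ)'s»)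

Cell `res-hironaka`, rung L, slot W4.5(b), width seat `res-L1-w45b-nose-w4` (WIDTH TABLE D2 «K-LOC», row (L-δ) second half; the desk's D2 UPDATE (4) lets the text
owner fold these into the (L-Ω) closing kit instead — filed only on the text owner's word). Crux CHILD EL♮(3) = stmt-ResolutionOfSingularities-20148. OURS · counted 0 ·
AI-written, weaker than expert review; nothing of [Hironaka2017] asserted; NOT a statement of the manuscript; resolution of singularities in positive characteristic
is NOT proved here. Def-free; pure logic over the tree's `₀`/`P` Props (✓ p649163 / p648724), R0 ✓ p648331 `ND.isRegularLocalRing_of_isNDFrameAt`, and the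
vocabulary of ✓ p643982 `…NatNDRoundModelSplit` — the originals `roundAtNDFrameLN_of_model` / `ndInvLN_round_of` / `linkedTower_of_goodPlay` /
`transportRoundLN_of_toricStage` (res-L1-w45b-lead-2 g6) with the ambient-regularity datum deleted (K-REG AUDIT option (i)).
`--supports stmt-ResolutionOfSingularities-20148 --as helper`.
-/

set_option linter.dupNamespace false

noncomputable section

open CategoryTheory CategoryTheory.Limits AlgebraicGeometry TopologicalSpace Topology IsLocalRing
open MvPolynomial
open Literature.AlgebraicGeometry.Resolution
open AlgebraicGeometry.Scheme.IdealSheafData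
open Summit.ResolutionOfSingularities.ResolutionOfSingularities.Cruxes.EquisingularLift.StrataSplit

namespace Summit.ResolutionOfSingularities.ResolutionOfSingularities.Cruxes.EquisingularLiftNat.Sections

open Summit.ResolutionOfSingularities.ResolutionOfSingularities.Cruxes.EquisingularLiftNat.Sections

namespace ND

section L0

variable (n : ℕ) (k : Type) [Field k]

/-- (B4α′-LN₀) from the model round and the `₀` transport (port l.195 re-cut: `hreg` gone). [OURS · pure logic · PROVED] -/
theorem roundAtNDFrameLN₀_of_model (hα : ∀ g : MvPolynomial (Fin n) k, LocalNDWon g → ModelRound n k g) (hβ : TransportRoundLN₀ n k) :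
    RoundAtNDFrameLN₀ n k := by
  intro F₁ ρ T₁ hLN hT₁ x hx W hW F₂ υ hυ
  obtain ⟨w, g, h1, h2, h3, h4, h5⟩ := hW
  exact hβ F₁ ρ T₁ hLN hT₁ x hx W w g h1 h2 h3 h4 h5 (hα g h4) F₂ υ hυ

/-- (B4-round-LN₀) `RoundFacts` for the POINTWISE invariant `NDInvCLNP` from `RoundAtNDFrameLN₀` and `NDInvPersists₀` (port l.203 re-cut: the round point's
`IsRegularLocalRing (F₁.presheaf.stalk z)` now comes from R0 ✓ p648331 at the leaf's frame instead of the global `hreg _`). [OURS · pure logic · PROVED] -/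
theorem ndInvLNP_round_of (hα : RoundAtNDFrameLN₀ n k) (hβ : NDInvPersists₀ n k) : RoundFacts n k (NDInvCLNP n k) := by
  intro m F₁ ρ T₁ h
  obtain ⟨⟨⟨S, hcard, hiff, hS⟩, hT₁⟩, hLN⟩ := h
  obtain ⟨x, hxS⟩ := Finset.card_pos.mp (by omega : 0 < S.card)
  obtain ⟨⟨z, hz⟩, hxcl, W, hW⟩ := hS x hxS
  subst hz
  have hnreg : ¬ IsRegularLocalRing ((AlgebraicGeometry.Scheme.IdealSheafData.vanishingIdeal
      (⟨closure T₁, isClosed_closure⟩ : TopologicalSpace.Closeds F₁)).subscheme.presheaf.stalk z) := fun hr => (hiff z).mp hr hxS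
  haveI : IsLocallyNoetherian F₁ := hLN
  refine ⟨z, hxcl, hnreg, isRegularLocalRing_of_isNDFrameAt n k hW, fun F₂ υ hυ => ?_⟩
  obtain ⟨F₉, β, T₉, htower, hLN₉, hT₉, hend, hiso, hbook⟩ := hα F₁ ρ T₁ hLN hT₁ _ hxcl W hW F₂ υ hυ
  refine ⟨F₉, β, T₉, ⟨hxcl, W, isFrameAt_of_isNDFrameAt n k hW, htower⟩, m, le_refl m, ⟨?_, hT₉⟩, hLN₉⟩
  exact hβ m F₁ ρ T₁ ⟨S, hcard, hiff, hS⟩ _ hxcl ⟨z, rfl, hnreg⟩ F₂ υ hυ F₉ β T₉ hT₉ hend hiso hbook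

/-- The linked F-side / A-side towers along a good play, `₀` version (port l.330 re-cut: the F-side step transport is `TransportStep₀`). [OURS · pure logic · PROVED] -/
theorem linkedTower_of_goodPlay₀
    (F₁ : AlgebraicGeometry.Scheme.{0}) (ρ : F₁ ⟶ (Literature.AlgebraicGeometry.Motives.projectiveSpace n k).left) (T₁ : Set F₁)
    (hLN : IsLocallyNoetherian F₁) (hT₁ : IsClosed T₁)
    (x : F₁) (hx : IsClosed ({x} : Set F₁)) (W : Fin n → F₁.IdealSheafData)
    (w : Fin n → F₁.presheaf.stalk x) (g : MvPolynomial (Fin n) k)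
    (h1 : ∀ j, stalkIdeal (W j) x = Ideal.span {w j})
    (h2 : Ideal.span (Set.range w) = IsLocalRing.maximalIdeal (F₁.presheaf.stalk x))
    (h3 : ringKrullDim (F₁.presheaf.stalk x) = (n : WithBot ℕ∞))
    (h4 : LocalNDWon g)
    (h5 : stalkIdeal (AlgebraicGeometry.Scheme.IdealSheafData.vanishingIdeal (⟨closure T₁, isClosed_closure⟩ : TopologicalSpace.Closeds F₁)) x =
      Ideal.span {MvPolynomial.eval₂ (baseToStalk n k ρ x) w g})
    (hS : ModelStep n k g) (tS : TransportStep₀ n k) {Φ Φ'' : Finset (Finset (Ray n))} (hP : GoodPlay n (table g) Φ Φ'') :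
    ∀ (F : AlgebraicGeometry.Scheme.{0}) (φF : F ⟶ F₁) (EF : Boundary n F) (TF : Set F)
      (A : AlgebraicGeometry.Scheme.{0}) (φA : A ⟶ Aff n k) (EA : Boundary n A) (TA : Set A),
      FStage n F₁ x hx T₁ F φF EF TF → Linked n k F₁ x (frameBaseMap n k ρ x w) F φF EF TF A φA EA TA → ToricStage n k g Φ A φA EA TA →
      ∃ (F₉ : AlgebraicGeometry.Scheme.{0}) (βF : F₉ ⟶ F) (T₉F : Set F₉) (E₉F : Boundary n F₉)
        (A₉ : AlgebraicGeometry.Scheme.{0}) (βA : A₉ ⟶ A) (T₉A : Set A₉) (E₉A : Boundary n A₉),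
        StrataTower F EF TF F₉ βF T₉F ∧ FStage n F₁ x hx T₁ F₉ (βF ≫ φF) E₉F T₉F ∧
        Linked n k F₁ x (frameBaseMap n k ρ x w) F₉ (βF ≫ φF) E₉F T₉F A₉ (βA ≫ φA) E₉A T₉A ∧ ToricStage n k g Φ'' A₉ (βA ≫ φA) E₉A T₉A := by
  induction hP with
  | done Φ =>
    intro F φF EF TF A φA EA TA hF hL hA
    refine ⟨F, 𝟙 F, TF, EF, A, 𝟙 A, TA, EA, StrataTower.nil F EF TF, ?_, ?_, ?_⟩
    · rw [CategoryTheory.Category.id_comp]; exact hF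
    · rw [CategoryTheory.Category.id_comp, CategoryTheory.Category.id_comp]; exact hL
    · rw [CategoryTheory.Category.id_comp]; exact hA
  | move Φ Φ' σ τ hσ hτσ hbad hnf hfresh hrest ih =>
    intro F φF EF TF A φA EA TA hF hL hA
    obtain ⟨⟨hE1A, hTA⟩, hstepA⟩ := hS Φ A φA EA TA hA σ hσ τ hτσ hbad hnf hfresh
    obtain ⟨A', υA, hυA⟩ := Literature.AlgebraicGeometry.Resolution.exists_isBlowup A (stratum EA τ)
    have hA' := hstepA A' υA hυA
    obtain ⟨⟨hE1F, hTF⟩, hstepF⟩ :=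
      tS F₁ ρ T₁ hLN hT₁ x hx W w g h1 h2 h3 h4 h5 Φ F φF EF TF A φA EA TA hF hL hA σ hσ τ hτσ hbad hnf hfresh hE1A hTA A' υA hυA hA'
    obtain ⟨F', υF, hυF⟩ := Literature.AlgebraicGeometry.Resolution.exists_isBlowup F (stratum EF τ)
    obtain ⟨hF', hL'⟩ := hstepF F' υF hυF
    obtain ⟨F₉, βF, T₉F, E₉F, A₉, βA, T₉A, E₉A, htower, hF₉, hL₉, hA₉⟩ := ih F' (υF ≫ φF) _ _ A' (υA ≫ φA) _ _ hF' hL' hA'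
    refine ⟨F₉, βF ≫ υF, T₉F, E₉F, A₉, βA ≫ υA, T₉A, E₉A, StrataTower.cons F EF TF τ hnf hE1F hTF F' υF hυF F₉ βF T₉F htower, ?_, ?_, ?_⟩
    · rw [CategoryTheory.Category.assoc]; exact hF₉
    · rw [CategoryTheory.Category.assoc, CategoryTheory.Category.assoc]; exact hL₉
    · rw [CategoryTheory.Category.assoc]; exact hA₉

/-- **THE (B4β₀) COMPOSITION, PROVED** (port l.374 re-cut: `hreg` gone, the end-ascent returns END only). [OURS · pure logic] -/
theorem transportRoundLN₀_of_toricStage (h0 : PlayFacts n) (hI : ∀ g : MvPolynomial (Fin n) k, LocalND g → ModelInit n k g)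
    (hS : ∀ g : MvPolynomial (Fin n) k, LocalND g → ModelStep n k g) (hE : ∀ g : MvPolynomial (Fin n) k, LocalND g → ModelEnd n k g)
    (tI : TransportInit₀ n k) (tS : TransportStep₀ n k) (tE : TransportEnd₀ n k) : TransportRoundLN₀ n k := by
  intro F₁ ρ T₁ hLN hT₁ x hx W w g h1 h2 h3 h4 h5 _hMR F₂ υ hυ
  obtain ⟨hL, Φ', hR, hW⟩ := h4
  have hV : (table g).Nonempty := table_nonempty (ne_zero_of_isLocallyND hL.2)
  obtain ⟨Φ'', hP, hW''⟩ := h0 (table g) (isConvenientTable_table hL.1) hV Φ' hR hW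
  obtain ⟨A₂, π₀, hπ₀⟩ := Literature.AlgebraicGeometry.Resolution.exists_isBlowup (Aff n k)
    (AlgebraicGeometry.Scheme.IdealSheafData.vanishingIdeal (⟨{affOrigin n k}, isClosed_affOrigin n k⟩ : TopologicalSpace.Closeds (Aff n k)))
  have hA₂ := hI g hL A₂ π₀ hπ₀
  obtain ⟨hF₂, hL₂⟩ := tI F₁ ρ T₁ hLN hT₁ x hx W w g h1 h2 h3 ⟨hL, Φ', hR, hW⟩ h5 F₂ υ hυ A₂ π₀ hπ₀
  obtain ⟨F₉, βF, T₉F, E₉F, A₉, βA, T₉A, E₉A, htower, hF₉, hL₉, hA₉⟩ :=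
    linkedTower_of_goodPlay₀ n k F₁ ρ T₁ hLN hT₁ x hx W w g h1 h2 h3 ⟨hL, Φ', hR, hW⟩ h5 (hS g hL) tS hP
      F₂ υ _ _ A₂ π₀ _ _ hF₂ hL₂ hA₂
  obtain ⟨hregA, hendA⟩ := hE g hL Φ'' A₉ (βA ≫ π₀) E₉A T₉A hA₉ hW''
  have hendF := tE F₁ ρ T₁ hLN hT₁ x hx W w g h1 h2 h3 ⟨hL, Φ', hR, hW⟩ h5 F₉ (βF ≫ υ) E₉F T₉F A₉ (βA ≫ π₀) E₉A T₉A hF₉ hL₉ ⟨Φ'', hA₉⟩ hregA hendA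
  obtain ⟨hLN₉, hiso, hbook, hclosed, -⟩ := hF₉
  exact ⟨F₉, βF, T₉F, htower, hLN₉, hclosed, hendF, hiso, hbook⟩

end L0

end ND

end Summit.ResolutionOfSingularities.ResolutionOfSingularities.Cruxes.EquisingularLiftNat.Sections

end
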